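import Summits.ValiantsHypothesis.ValiantsHypothesis.Theorems.GrenetZeonDualUnipotentThreeHalvesRadicalCoarseningTrace

/-!
# `GrenetZeon.DualUnipotentThreeHalves` (stmt-ValiantsHypothesis-24318), stub (c) — the EXCHANGEABILITY LEMMA:
# a commutator trace-orthogonal to the generated algebra forces a COMMON EIGENVECTOR

leafhand-val-grenetzeon-2 gen28 (29th hand), 2026-09-01; lemma (E) of the census `Cruxes/DualUnipotentThreeHalves/CENSUS-leafhand2-g28-bipartite-graft.md` §4.

WHY.  The MOR inflation mechanism behind every printed fat irreducible nil space — `V = {X ⊗ g + Y ⊗ h : (X, Y) ∈ 𝒲}` for a nil plane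
`Π = span{g, h}` — is nil as soon as the word traces `tr w(X,Y)` are COUNT-DETERMINED on `𝒲` (`tr M^k = Σ_d τ_d · [x^{k−d}y^d] tr((xg+yh)^k) = 0`).
Count-determined traces give `tr(u · (XY − YX)) = 0` for every word `u`, i.e. the commutator is TRACE-ORTHOGONAL to the unital algebra `ℂ⟨X, Y⟩`;
this file proves that this alone forces a common eigenvector of `X` and `Y` (and, iterating on quotients — not done here — a common flag): such `𝒲`
live in a Borel pair, so these inflations are block-band CHEAP and never (c)-violators.  Proof: by ✓ `RadicalCoarsening.mem_jacobson_of_traceOrth`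
the commutator lies in the Jacobson radical `J` of `𝒜 = ℂ⟨X,Y⟩`; `J` is nilpotent (✓ `exists_jacobson_pow_eq_bot`, ✓ `prod_eq_zero_of_mem_jacobson`),
so the common kernel `S` of `J` is non-zero (`exists_common_kernel_of_jacobson`); `S` is `𝒜`-invariant, `X` and `Y` commute on `S`, and two
commuting endomorphisms of `S ≠ 0` share an eigenvector (Mathlib `Module.End.exists_eigenvalue` twice).

* `exists_common_kernel_of_jacobson` — for a matrix subalgebra `𝒜 ≤ M_m(ℂ)`, `m ≥ 1`: some `v ≠ 0` is killed by every element of `J(𝒜)`.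
* ★ `exists_common_eigenvector_of_commutator_traceOrth` — `tr((XY − YX)·b) = 0` for all `b ∈ ℂ⟨X,Y⟩`, `m ≥ 1` ⇒ `X`, `Y` have a common eigenvector.

Honest framing.  Helper (`--supports stmt-ValiantsHypothesis-24318`); nothing here proves (c), S3, 24318, 8062 or `VP ≠ VNP` — all OPEN / NOT
proved.  No definitions, no sorry, standard axioms. [folklore: Wedderburn–Malcev / Jacobson radical argument]
-/

set_option linter.dupNamespace false
set_option autoImplicit false

namespace Summit.ValiantsHypothesis.ValiantsHypothesis.Theorems.GrenetZeon.BipartiteGraft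

open Matrix
open scoped BigOperators
open Summit.ValiantsHypothesis.ValiantsHypothesis.Theorems.GrenetZeon.RadicalCoarsening
  (mem_jacobson_of_traceOrth exists_jacobson_pow_eq_bot prod_eq_zero_of_mem_jacobson)

variable {m : ℕ}

/-- **The common kernel of the Jacobson radical is non-zero.**  For a subalgebra `𝒜 ≤ M_m(ℂ)` with `m ≥ 1` there is a non-zero vector killed
by every element of `J(𝒜)` (products of `L` radical elements vanish; a longest non-vanishing chain applied to a vector ends in the common kernel).
[folklore] -/
theorem exists_common_kernel_of_jacobson (𝒜 : Subalgebra ℂ (Matrix (Fin m) (Fin m) ℂ)) (hm : 0 < m) :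
    ∃ v : Fin m → ℂ, v ≠ 0 ∧ ∀ j : 𝒜, j ∈ Ideal.jacobson (⊥ : Ideal 𝒜) → (j : Matrix (Fin m) (Fin m) ℂ) *ᵥ v = 0 := by
  classical
  obtain ⟨L, hL⟩ := exists_jacobson_pow_eq_bot 𝒜
  by_contra hcon
  push Not at hcon
  -- chains of radical elements of every length that do not kill a given non-zero vector
  have key : ∀ (t : ℕ) (v : Fin m → ℂ), v ≠ 0 → ∃ f : Fin t → 𝒜, (∀ i, f i ∈ Ideal.jacobson (⊥ : Ideal 𝒜)) ∧
      (((List.ofFn f).prod : 𝒜) : Matrix (Fin m) (Fin m) ℂ) *ᵥ v ≠ 0 := by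
    intro t
    induction t with
    | zero =>
      intro v hv
      refine ⟨fun i => Fin.elim0 i, fun i => Fin.elim0 i, ?_⟩
      rw [List.ofFn_zero, List.prod_nil, Subalgebra.coe_one, Matrix.one_mulVec]
      exact hv
    | succ t ih =>
      intro v hv
      obtain ⟨f, hf, hfv⟩ := ih v hv
      obtain ⟨j, hj, hjw⟩ := hcon _ hfv
      refine ⟨Fin.cons j f, fun i => Fin.cases hj (fun i => hf i) i, ?_⟩
      rw [List.ofFn_succ, List.prod_cons]
      simp only [Fin.cons_zero, Fin.cons_succ]
      rw [Subalgebra.coe_mul, ← Matrix.mulVec_mulVec]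
      exact hjw
  obtain ⟨f, hf, hfv⟩ := key L (Pi.single (⟨0, hm⟩ : Fin m) (1 : ℂ)) (by
    intro h
    have := congrFun h ⟨0, hm⟩
    simp at this)
  apply hfv
  rw [prod_eq_zero_of_mem_jacobson 𝒜 hL f hf, Subalgebra.coe_zero, Matrix.zero_mulVec]

/-- ★ **EXCHANGEABILITY LEMMA.**  If the commutator `XY − YX` is trace-orthogonal to the unital algebra generated by `X` and `Y` (e.g. if all
word traces of `(X, Y)` are count-determined), then `X` and `Y` have a common eigenvector (`m ≥ 1`). [folklore] -/
theorem exists_common_eigenvector_of_commutator_traceOrth (X Y : Matrix (Fin m) (Fin m) ℂ) (hm : 0 < m)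
    (h : ∀ b ∈ Algebra.adjoin ℂ ({X, Y} : Set (Matrix (Fin m) (Fin m) ℂ)), Matrix.trace ((X * Y - Y * X) * b) = 0) :
    ∃ v : Fin m → ℂ, v ≠ 0 ∧ (∃ a : ℂ, X *ᵥ v = a • v) ∧ (∃ c : ℂ, Y *ᵥ v = c • v) := by
  classical
  set 𝒜 := Algebra.adjoin ℂ ({X, Y} : Set (Matrix (Fin m) (Fin m) ℂ)) with h𝒜
  have hX : X ∈ 𝒜 := Algebra.subset_adjoin (by simp)
  have hY : Y ∈ 𝒜 := Algebra.subset_adjoin (by simp)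
  have hC : X * Y - Y * X ∈ 𝒜 := Subalgebra.sub_mem _ (Subalgebra.mul_mem _ hX hY) (Subalgebra.mul_mem _ hY hX)
  have hJ := mem_jacobson_of_traceOrth 𝒜 hC h
  -- the common kernel `S` of the radical
  let S : Submodule ℂ (Fin m → ℂ) :=
    ⨅ (j : 𝒜) (_ : j ∈ Ideal.jacobson (⊥ : Ideal 𝒜)), LinearMap.ker (Matrix.toLin' (j : Matrix (Fin m) (Fin m) ℂ))
  have hS : ∀ v : Fin m → ℂ, v ∈ S ↔ ∀ j : 𝒜, j ∈ Ideal.jacobson (⊥ : Ideal 𝒜) → (j : Matrix (Fin m) (Fin m) ℂ) *ᵥ v = 0 := by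
    intro v
    simp only [S, Submodule.mem_iInf, LinearMap.mem_ker, Matrix.toLin'_apply]
  -- `S ≠ ⊥`
  obtain ⟨v₀, hv₀, hv₀S⟩ := exists_common_kernel_of_jacobson 𝒜 hm
  have hSne : S ≠ ⊥ := by
    intro hbot
    apply hv₀
    have : v₀ ∈ S := (hS v₀).2 hv₀S
    rw [hbot] at this
    exact (Submodule.mem_bot ℂ).1 this
  -- `S` is invariant under `𝒜`
  have hinv : ∀ a ∈ 𝒜, ∀ v ∈ S, a *ᵥ v ∈ S := by
    intro a ha v hv
    rw [hS] at hv ⊢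
    intro j hj
    have hja : j * ⟨a, ha⟩ ∈ Ideal.jacobson (⊥ : Ideal 𝒜) := Ideal.mul_mem_right _ _ hj
    have := hv (j * ⟨a, ha⟩) hja
    rw [Subalgebra.coe_mul, ← Matrix.mulVec_mulVec] at this
    exact this
  -- `X` and `Y` commute on `S`
  have hcomm : ∀ v ∈ S, X *ᵥ (Y *ᵥ v) = Y *ᵥ (X *ᵥ v) := by
    intro v hv
    have := ((hS v).1 hv) ⟨X * Y - Y * X, hC⟩ hJ
    rw [Matrix.sub_mulVec, sub_eq_zero, ← Matrix.mulVec_mulVec, ← Matrix.mulVec_mulVec] at this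
    exact this
  -- restrict to `S`
  haveI : Nontrivial S := Submodule.nontrivial_iff_ne_bot.mpr hSne
  let fX : Module.End ℂ S := (Matrix.toLin' X).restrict (fun v hv => by rw [Matrix.toLin'_apply]; exact hinv X hX v hv)
  let fY : Module.End ℂ S := (Matrix.toLin' Y).restrict (fun v hv => by rw [Matrix.toLin'_apply]; exact hinv Y hY v hv)
  have hfX : ∀ w : S, ((fX w : S) : Fin m → ℂ) = X *ᵥ (w : Fin m → ℂ) := fun w => rfl
  have hfY : ∀ w : S, ((fY w : S) : Fin m → ℂ) = Y *ᵥ (w : Fin m → ℂ) := fun w => rfl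
  obtain ⟨μ, hμ⟩ := Module.End.exists_eigenvalue fX
  -- the `μ`-eigenspace of `fX` is `fY`-invariant
  set E := fX.eigenspace μ with hE
  have hEinv : ∀ w ∈ E, fY w ∈ E := by
    intro w hw
    rw [hE, Module.End.mem_eigenspace_iff] at hw ⊢
    apply Subtype.ext
    rw [hfX, hfY, Submodule.coe_smul, hfY, hcomm _ w.2, ← hfX, hw, Submodule.coe_smul, Matrix.mulVec_smul]
  haveI : Nontrivial E := Submodule.nontrivial_iff_ne_bot.mpr hμ
  let gY : Module.End ℂ E := fY.restrict hEinv
  obtain ⟨ν, hν⟩ := Module.End.exists_eigenvalue (K := ℂ) (V := ↥E) gY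
  obtain ⟨w, hw⟩ := hν.exists_hasEigenvector
  -- the common eigenvector
  refine ⟨((w : S) : Fin m → ℂ), ?_, ⟨μ, ?_⟩, ⟨ν, ?_⟩⟩
  · intro h0
    apply hw.2
    apply Subtype.ext
    apply Subtype.ext
    rw [h0]
    rfl
  · have h1' : (w : S) ∈ fX.eigenspace μ := hE ▸ w.2
    have h1 : fX (w : S) = μ • (w : S) := Module.End.mem_eigenspace_iff.mp h1'
    have h2 := congrArg (fun z : S => (z : Fin m → ℂ)) h1
    simp only [hfX, Submodule.coe_smul] at h2
    exact h2
  · have h1 := hw.apply_eq_smul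
    have h2 := congrArg (fun z : E => ((z : S) : Fin m → ℂ)) h1
    simp only [gY, LinearMap.restrict_apply, Submodule.coe_smul, hfY] at h2
    exact h2

end Summit.ValiantsHypothesis.ValiantsHypothesis.Theorems.GrenetZeon.BipartiteGraft
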